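import Summits.BirchSwinnertonDyer.Rank1Residual.Additive.X4RankZeroVisibleRefinedCertificateSockets
import Summits.BirchSwinnertonDyer.Rank1Residual.GaloisImage.VisThreeESideInstancesP1
import Summits.BirchSwinnertonDyer.Rank1Residual.GaloisImage.LocalThreeTorsionAdicCompletion
import Summits.BirchSwinnertonDyer.Rank1Residual.GaloisImage.LocalTorsionAwayFromPAdicCompletion
import Summits.BirchSwinnertonDyer.Rank1Residual.GaloisImage.PadicTwistClassDecider
import Summits.BirchSwinnertonDyer.Rank1Residual.Additive.IntModelTamagawaCertificateLocal
import Summits.BirchSwinnertonDyer.Rank1Residual.Additive.JValuationOfIntModel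
import Summits.BirchSwinnertonDyer.Rank1Residual.X11b.VisibilityPrimeList
import Literature.NumberTheory.EllipticCurves.HondaStrongIsomorphismMultiplicativeProofs
import HarnessLib

/-!
# T-NSK-REC ROW SHAPES, batch 2: `BSD(E,3)` for `27954c1` (partner `13977a1`) and `61326h1` (partner
# `30663a1`) over the REFINED seven-kind certificate — the place `3` PAID (`t₃ = 1`), the place `2` FREE
# of kind (iv′), the remaining bad place of kind (iii); every local binder IN THE KERNEL
# (cell `b2b-bsdres`, team n1011, ROW T-2LL FILE 8; lead R5-86 (r) "one or two of the 7 PASS⁺ rows";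
# seat p04 GEN 11; token-for-token the pilot `X4ThreeVisibleNskRowShape62514b1.lean` (FILE 7) over
# FILE 6's socket `X4RankZero.bsdp_three_potMult_of_congr_of_places₇_of_primeList_paidThree`; these two
# rows need NO tame Tamagawa certificate: their places are `2` (iv′), `3` (paid, n1011-p17's decider) and
# one prime of kind (iii))

HONEST FRAMING (cell `b2b-bsdres`, run/shared/lean/b2b/bsd-rank1-residual/, verbatim in every
file): the goal of the cell is to DELETE the COMBINATION-SHAPED residual classes of the
Birch–Swinnerton-Dyer formula for ALL analytic-rank `≤ 1` elliptic curves over `ℚ` — "full BSD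
formula for every rank `≤ 1` curve in class `C`" assembled STRICTLY from published theorems — so
that the rank-`≤ 1` remainder becomes exactly the CONSTRUCTION-SHAPED classes, which are TYPED
(missing-input `Prop`s), NOT attempted. This is not "finishing BSD". Team n1011 (N11 = X4 ∧ `p = 3`),
research route; a ROW SHAPE closes NO class and moves no mark / label / count; nothing booked;
theorems only (no definition, no named fact, no `sorry`).

RULING OF RECORD for row shapes (n1011 lead GEN 8, R5-82 (d), verbatim): "T-VIS3 (iv) ROW SHAPE —
evidence columns displayed as binders, provenance: θ = r1 g29 tables (+ KO/Fisher certificate when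
landed), rank E′ = Cremona/bsdr2, r_an/#Ш_an = Cremona allbsd + engine P; nothing booked; closes
nothing beyond its displayed binders; census count unchanged".

## What (route planner 1 `g29_cvis_pairs.tsv`, road PASS⁺ of ROUTE-1 §41.9)

* **`bsdp3_visN_v27954c1`** — `27954c1 = [1, -1, 0, -22050, -1232492]` (`N = 27954 = 2·3²·1553`; X4 at
  `3`, (M): `I₄*`, `ord₃ j = -4`; `r_an = 0`, `ord₃ #Ш_an = 2`), partner `13977a1 = [0, 0, 1, 24, 76]`
  (rank `2`); places `2:nonsplit/good:3:PAID → kind (iv′); 3:add-pm/add-pm:1:PAY3 → PAID, t₃ = 1;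
  1553:nonsplit/nonsplit:3:iii → kind (iii)`; `|Δ(E)| = 2¹⁸·3¹⁰·1553`, `|Δ(E′)| = 3⁷·1553`.
* **`bsdp3_visN_v61326h1`** — `61326h1 = [1, -1, 0, -12348, -539312]` (`N = 61326 = 2·3²·3407`; X4 at
  `3`, (M): `I₄*`, `ord₃ j = -4`; `r_an = 0`, `ord₃ #Ш_an = 2`), partner `30663a1 = [0, 0, 1, -354, 2560]`
  (rank `2`); places `2:nonsplit/good:3:PAID → kind (iv′); 3 → PAID, t₃ = 1; 3407 → kind (iii)`;
  `|Δ(E)| = 2¹⁵·3¹⁰·3407`, `|Δ(E′)| = 3⁷·3407`.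

KERNEL per row: surj(3) = n1011-p14's `GaloisImage.surj3_frob_v<label>` (E-INST-P1, BY NAME); X4 and
`ord₃ j < 0` from the integer model; partner globally minimal (bounded Kraus); the place `3`:
n1011-p17's decider `LocalTorsion3.natCard_ker_nsmul_three_adicCompletion_eq_one_of_check` with the
certificate `k = 2`, ball `(24, 1, 3, 0)`, `S = 0` (found by n1011-p17's `census/loc3t_cert2.py`
UNCHANGED via n1011-p18's `tools/vis3_certs.py`), budget `3·1 < 3²`; the place `2`: `E` multiplicative
(`2 ∣ Δ`, `2 ∤ c₄`), NON-SPLIT (`sqFlagAt 2 (N·D) 0 = false` on `γ(E) = −c₄/c₆`), `E′` good (`2 ∤ Δ(E′)`);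
the kind-(iii) place: both multiplicative, same twist class (`sqFlagAt ℓ (N·D) 0 = true` on
`γ(E)/γ(E′)`), `μ₃(ℚ_ℓ) = 1` (`ℓ ≡ 2 (mod 3)`, `sqFlagAt ℓ (−3) 0 = false`).  DISPLAYED = EVIDENCE:
`θ`/`hθ`, `hrank`, `hr`, `hq`/`hv`.  Numerals re-derived by the seat's `work/pilot/numerals.py`.

References: [CremonaMazur2000] §3 and Table 1; [AgasheStein2002] Thm. 3.1; [Delbourgo1998] Prop. 4;
[MilneADT2006] I.3.8; [SilvermanAEC2009] VII.5.1, X.4.2, X.4.14; [SilvermanATAEC1994] V.5.2–5.4;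
[Serre1973] II.3.3; [Cremona2006] (labels 27954c1, 13977a1, 61326h1, 30663a1).
-/

set_option autoImplicit false

noncomputable section

open scoped Classical NumberField
open IsDedekindDomain NumberField WeierstrassCurve Rat.HeightOneSpectrum
  Literature.NumberTheory.EllipticCurves Literature.NumberTheory.EllipticCurves.ModularForms
  Literature.NumberTheory.EllipticCurves.Rank1Residual
  Literature.NumberTheory.EllipticCurves.Rank1Residual.Typed
  Literature.NumberTheory.GaloisRepresentations
  Summit.BirchSwinnertonDyer.BirchSwinnertonDyer.Rank1Residual.IntModel
  Summit.BirchSwinnertonDyer.BirchSwinnertonDyer.Rank1Residual.X11RankOne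
  Summit.BirchSwinnertonDyer.BirchSwinnertonDyer.Rank2Observatory
  Summit.BirchSwinnertonDyer.BirchSwinnertonDyer.Rank2Observatory.Tam
  Summit.BirchSwinnertonDyer.Rank1Residual.GaloisImage

namespace Summit.BirchSwinnertonDyer.Rank1Residual.Additive

/-! ### `27954c1` ~ `13977a1` -/

/-- **KIND (iii) NUMERALS for `27954c1 ~ 13977a1` at the place of `1553`, decided**: `γ(E)/γ(E′) = N/D` with
`N = 117601`, `D = 2078224`, `1553 ∤ N·D`, `sqFlagAt 1553 (N·D) 0 = true`, and `μ₃(ℚ_1553) = 1`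
(`1553 ≡ 2 (mod 3)`: `sqFlagAt 1553 (−3) 0 = false`). [cite: SilvermanATAEC1994, Ch. V Lemma 5.2 (c), Thm. 5.3]
[cite: Serre1973, Ch. II §3.3] -/
theorem kind_iii_numerals_27954c1_13977a1_at1553 (W E' : WeierstrassCurve ℚ)
    (hW : W = ⟨1, -1, 0, -22050, -1232492⟩) (hE' : E' = ⟨0, 0, 1, 24, 76⟩)
    {v : HeightOneSpectrum (𝓞 ℚ)} (hv : (primesEquiv v : ℕ) = 1553) :
    (∃ r : v.adicCompletion ℚ, algebraMap ℚ (v.adicCompletion ℚ) (-(W.c₄ / W.c₆)) =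
        r ^ 2 * algebraMap ℚ (v.adicCompletion ℚ) (-(E'.c₄ / E'.c₆))) ∧
      (∀ ζ : v.adicCompletion ℚ, ζ ^ 3 = 1 → ζ = 1) := by
  haveI : Fact (Nat.Prime 1553) := ⟨by norm_num⟩
  subst hW; subst hE'
  refine ⟨?_, LocalTorsion3At.forall_pow_three_eq_one_adicCompletion_of_sqFlagAt v hv (w₃ := 0)
    (by norm_num) (by norm_num) (by decide +kernel)⟩
  refine LocalTorsion3At.exists_eq_sq_mul_of_sqFlagAt v hv (N := 117601)
    (D := 2078224) ?_ (by norm_num) ?_ (w := 0) (by norm_num) (by norm_num) (by decide +kernel)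
  · norm_num [WeierstrassCurve.c₄, WeierstrassCurve.c₆, WeierstrassCurve.b₂, WeierstrassCurve.b₄,
      WeierstrassCurve.b₆]
  · norm_num [WeierstrassCurve.c₄, WeierstrassCurve.c₆, WeierstrassCurve.b₂, WeierstrassCurve.b₄,
      WeierstrassCurve.b₆]

/-- **NON-SPLIT NUMERAL for `27954c1` at the place of `2`, decided** (kind (iv′)'s `¬ IsSquare (ι γ(E))`):
`γ(E) = −c₄/c₆ = -117601/118848435`, `2 ∤ N·D`, `sqFlagAt 2 (N·D) 0 = false` (`N·D ≢ 1 (mod 8)`).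
[cite: SilvermanATAEC1994, Ch. V Thm. 5.3 (b)] [cite: Serre1973, Ch. II §3.3] -/
theorem nonsplit_numeral_27954c1_at2 (W : WeierstrassCurve ℚ) (hW : W = ⟨1, -1, 0, -22050, -1232492⟩)
    {v : HeightOneSpectrum (𝓞 ℚ)} (hv : (primesEquiv v : ℕ) = 2) :
    ¬ IsSquare (algebraMap ℚ (v.adicCompletion ℚ) (-(W.c₄ / W.c₆))) := by
  haveI : Fact (Nat.Prime 2) := ⟨Nat.prime_two⟩
  subst hW
  exact LocalTorsion3At.not_isSquare_algebraMap_adicCompletion_of_sqFlagAt v hv (N := -117601)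
    (D := 118848435) (by norm_num)
    (by norm_num [WeierstrassCurve.c₄, WeierstrassCurve.c₆, WeierstrassCurve.b₂, WeierstrassCurve.b₄,
      WeierstrassCurve.b₆]) (w := 0) (by norm_num) (by norm_num) (by decide +kernel)

/-- **T-NSK-REC ROW SHAPE (CLOSES NOTHING, moves no mark): `BSD(E,3)` for `27954c1` from its `3`-congruent
rank-2 partner `13977a1` over the refined seven-kind certificate — the place `3` PAID (`#E′(ℚ₃)[3] = 1`,
budget `3 < 3²`), the place `2` of kind (iv′), the place `1553` of kind (iii); every local binder in the
kernel.** [cite: CremonaMazur2000, §3 and Table 1] [cite: AgasheStein2002, Thm. 3.1]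
[cite: MilneADT2006, Ch. I Prop. 3.8] [cite: SilvermanATAEC1994, Ch. V Lemma 5.2 (c), Thm. 5.3, Cor. 5.4]
[cite: SilvermanAEC2009, VII.5 Prop. 5.1, Thm. X.4.2 (a) and X.4.14]
[cite: Cremona2006, Table 1 (labels 27954c1, 13977a1)] -/
theorem bsdp3_visN_v27954c1
    (hKatoS : Kato2004.rankZero_padicValNat_sha_le_sub_localTamagawa_of_additive_potGood_of_imageContainsSL2)
    (hDel : Delbourgo1998.prop4_rankZero_pow_dvd_constantCoeff)
    (hGZK : rank_eq_analyticRank_of_analyticRank_le_one) (hmod : hasEntireLFunction_rat)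
    (hmodD : nonempty_modularParametrizationData)
    (hKatoχ : Wuthrich2014.kato_halfEigenCharIdeal_dvd_cyclotomicPrime_of_surjective)
    (hCT : exists_casselsTate_pairing (K := ℚ))
    (hU : Silverman1994_thmV53_tateUniformisation.{0})
    (hU2 : Silverman1994_thmV53_corV54_tateUniformisation.{0})
    (W : WeierstrassCurve ℚ) [W.IsElliptic] [W.IsGloballyMinimal]
    (hI : integralModelInt W = ⟨1, -1, 0, -22050, -1232492⟩)
    (hr : W.analyticRank = 0)
    {q : ℚ} (hq : shaAn W = (q : ℂ)) (hv : padicValRat 3 q ≤ 2)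
    (W' : WeierstrassCurve ℚ) (hW' : W' = ⟨0, 0, 1, 24, 76⟩) [W'.IsElliptic]
    (θ : geomTorsion W' ((3 : ℕ) : ℤ) ≃+ geomTorsion W ((3 : ℕ) : ℤ))
    (hθ : ∀ (σ : Field.absoluteGaloisGroup ℚ) (P : geomTorsion W' ((3 : ℕ) : ℤ)),
      θ (σ • P) = σ • θ P)
    (hrank : 2 ≤ W'.mordellWeilRank) :
    haveI : Fact (Nat.Prime 3) := ⟨Nat.prime_three⟩
    BSDp W 3 := by
  haveI : Fact (Nat.Prime 3) := ⟨Nat.prime_three⟩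
  -- the row `27954c1`
  have hsurj : W.HasSurjectiveModNGaloisRep 3 := GaloisImage.surj3_frob_v27954c1 hI
  have hX : ClassX4 W 3 :=
    ⟨by norm_num, addv_of_intModel hI 3 (by decide) (by decide),
      hasIrreducibleModPGaloisRep_of_hasSurjectiveModNGaloisRep W 3 hsurj⟩
  have hj : padicValRat 3 W.j < 0 :=
    padicValRat_j_neg_of_intModel hI (p := 3) 2 (by decide) (by decide)
  have hE : (⟨1, -1, 0, -22050, -1232492⟩ : WeierstrassCurve ℤ).map (Int.castRingHom ℚ) = W := by
    rw [IntModelTam.eq_baseChange_of_integralModelInt hI]; rfl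
  have hW : W = ⟨1, -1, 0, -22050, -1232492⟩ := by
    rw [← hE]; exact map_mk_int 1 (-1) 0 (-22050) (-1232492)
  -- the partner `13977a1`: globally minimal, integral model
  haveI hM' : W'.IsGloballyMinimal := by
    rw [hW']
    exact isGloballyMinimal_of_krausCriterion_bounded 0 0 1 24 76
      (by decide +kernel) (by decide +kernel) (by decide +kernel)
  have hI' : integralModelInt W' = ⟨0, 0, 1, 24, 76⟩ := by
    subst hW'; exact integralModelInt_eq_of_map_eq _ (map_mk_int 0 0 1 24 76)
  have hF : (⟨0, 0, 1, 24, 76⟩ : WeierstrassCurve ℤ).map (Int.castRingHom ℚ) = W' := by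
    rw [hW']; exact map_mk_int 0 0 1 24 76
  refine X4RankZero.bsdp_three_potMult_of_congr_of_places₇_of_primeList_paidThree hKatoS hDel hGZK
    hmod hmodD hKatoχ hCT hU hU2 W hr hX hsurj hj hq hv W' θ hθ (t := 1) (k := 2)
    (fun w hw ↦ (LocalTorsion3.natCard_ker_nsmul_three_adicCompletion_eq_one_of_check 0 0 1 24 76
      (by decide +kernel) (k := 2) (cert := [((24 : ℤ), 1, 3, 0)]) (by decide +kernel) W' hW' hw).le)
    (by norm_num) hrank hE hF [2, 3, 1553] (by decide)
    (X11b.forall_mem_of_natAbs_eq_prod_pow [2, 3, 1553] [18, 10, 1] (by intro q hq; simp only [List.mem_cons, List.mem_nil_iff, or_false] at hq; rcases hq with rfl | rfl | rfl <;> norm_num) (by decide +kernel))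
    (X11b.forall_mem_of_natAbs_eq_prod_pow [2, 3, 1553] [0, 7, 1] (by intro q hq; simp only [List.mem_cons, List.mem_nil_iff, or_false] at hq; rcases hq with rfl | rfl | rfl <;> norm_num) (by decide +kernel))
    (fun v hvL hv3 ↦ ?_)
  simp only [List.mem_cons, List.mem_nil_iff, or_false] at hvL
  rcases hvL with h2 | h3 | hℓ
  · -- `v = 2`: kind (iv′) — `E` non-split multiplicative, `E′` good, `2 ≠ 3`
    have h2z : ((primesEquiv v : ℕ) : ℤ) = ((2 : ℕ) : ℤ) := by rw [h2]
    refine Or.inr <| Or.inr <| Or.inr <| Or.inl ⟨?_, nonsplit_numeral_27954c1_at2 W hW h2, ?_, ?_⟩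
    · exact W.hasMultiplicativeReductionAt_of_dvd_of_not_dvd v
        (by rw [minimalDiscriminantInt, hI, h2z]; decide +kernel) (by rw [hI, h2z]; decide +kernel)
    · rw [← hF]
      exact hasGoodReductionAt_map_of_not_dvd _ v (by rw [h2z]; decide +kernel)
    · intro hmem
      have h3' := Rat.HeightOneSpectrum.primesEquiv_eq_of_natCast_mem v Nat.prime_three hmem
      omega
  · -- `v = 3`: the PAID place, excluded here
    exact absurd h3 hv3
  · -- `v = 1553`: kind (iii) — both multiplicative, same twist class, `μ₃ = 1`
    have hℓz : ((primesEquiv v : ℕ) : ℤ) = ((1553 : ℕ) : ℤ) := by rw [hℓ]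
    refine Or.inr <| Or.inr <| Or.inl ⟨?_, ?_, kind_iii_numerals_27954c1_13977a1_at1553 W W' hW hW' hℓ⟩
    · exact W.hasMultiplicativeReductionAt_of_dvd_of_not_dvd v
        (by rw [minimalDiscriminantInt, hI, hℓz]; decide +kernel) (by rw [hI, hℓz]; decide +kernel)
    · exact W'.hasMultiplicativeReductionAt_of_dvd_of_not_dvd v
        (by rw [minimalDiscriminantInt, hI', hℓz]; decide +kernel) (by rw [hI', hℓz]; decide +kernel)

/-! ### `61326h1` ~ `30663a1` -/

/-- **KIND (iii) NUMERALS for `61326h1 ~ 30663a1` at the place of `3407`, decided**: `γ(E)/γ(E′) = N/D` with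
`N = -674441537`, `D = 4096197484`, `3407 ∤ N·D`, `sqFlagAt 3407 (N·D) 0 = true`, and `μ₃(ℚ_3407) = 1`
(`3407 ≡ 2 (mod 3)`: `sqFlagAt 3407 (−3) 0 = false`). [cite: SilvermanATAEC1994, Ch. V Lemma 5.2 (c), Thm. 5.3]
[cite: Serre1973, Ch. II §3.3] -/
theorem kind_iii_numerals_61326h1_30663a1_at3407 (W E' : WeierstrassCurve ℚ)
    (hW : W = ⟨1, -1, 0, -12348, -539312⟩) (hE' : E' = ⟨0, 0, 1, -354, 2560⟩)
    {v : HeightOneSpectrum (𝓞 ℚ)} (hv : (primesEquiv v : ℕ) = 3407) :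
    (∃ r : v.adicCompletion ℚ, algebraMap ℚ (v.adicCompletion ℚ) (-(W.c₄ / W.c₆)) =
        r ^ 2 * algebraMap ℚ (v.adicCompletion ℚ) (-(E'.c₄ / E'.c₆))) ∧
      (∀ ζ : v.adicCompletion ℚ, ζ ^ 3 = 1 → ζ = 1) := by
  haveI : Fact (Nat.Prime 3407) := ⟨by norm_num⟩
  subst hW; subst hE'
  refine ⟨?_, LocalTorsion3At.forall_pow_three_eq_one_adicCompletion_of_sqFlagAt v hv (w₃ := 0)
    (by norm_num) (by norm_num) (by decide +kernel)⟩
  refine LocalTorsion3At.exists_eq_sq_mul_of_sqFlagAt v hv (N := -674441537)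
    (D := 4096197484) ?_ (by norm_num) ?_ (w := 0) (by norm_num) (by norm_num) (by decide +kernel)
  · norm_num [WeierstrassCurve.c₄, WeierstrassCurve.c₆, WeierstrassCurve.b₂, WeierstrassCurve.b₄,
      WeierstrassCurve.b₆]
  · norm_num [WeierstrassCurve.c₄, WeierstrassCurve.c₆, WeierstrassCurve.b₂, WeierstrassCurve.b₄,
      WeierstrassCurve.b₆]

/-- **NON-SPLIT NUMERAL for `61326h1` at the place of `2`, decided** (kind (iv′)'s `¬ IsSquare (ι γ(E))`):
`γ(E) = −c₄/c₆ = -65857/52070307`, `2 ∤ N·D`, `sqFlagAt 2 (N·D) 0 = false` (`N·D ≢ 1 (mod 8)`).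
[cite: SilvermanATAEC1994, Ch. V Thm. 5.3 (b)] [cite: Serre1973, Ch. II §3.3] -/
theorem nonsplit_numeral_61326h1_at2 (W : WeierstrassCurve ℚ) (hW : W = ⟨1, -1, 0, -12348, -539312⟩)
    {v : HeightOneSpectrum (𝓞 ℚ)} (hv : (primesEquiv v : ℕ) = 2) :
    ¬ IsSquare (algebraMap ℚ (v.adicCompletion ℚ) (-(W.c₄ / W.c₆))) := by
  haveI : Fact (Nat.Prime 2) := ⟨Nat.prime_two⟩
  subst hW
  exact LocalTorsion3At.not_isSquare_algebraMap_adicCompletion_of_sqFlagAt v hv (N := -65857)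
    (D := 52070307) (by norm_num)
    (by norm_num [WeierstrassCurve.c₄, WeierstrassCurve.c₆, WeierstrassCurve.b₂, WeierstrassCurve.b₄,
      WeierstrassCurve.b₆]) (w := 0) (by norm_num) (by norm_num) (by decide +kernel)

/-- **T-NSK-REC ROW SHAPE (CLOSES NOTHING, moves no mark): `BSD(E,3)` for `61326h1` from its `3`-congruent
rank-2 partner `30663a1` over the refined seven-kind certificate — the place `3` PAID (`#E′(ℚ₃)[3] = 1`,
budget `3 < 3²`), the place `2` of kind (iv′), the place `3407` of kind (iii); every local binder in the
kernel.** [cite: CremonaMazur2000, §3 and Table 1] [cite: AgasheStein2002, Thm. 3.1]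
[cite: MilneADT2006, Ch. I Prop. 3.8] [cite: SilvermanATAEC1994, Ch. V Lemma 5.2 (c), Thm. 5.3, Cor. 5.4]
[cite: SilvermanAEC2009, VII.5 Prop. 5.1, Thm. X.4.2 (a) and X.4.14]
[cite: Cremona2006, Table 1 (labels 61326h1, 30663a1)] -/
theorem bsdp3_visN_v61326h1
    (hKatoS : Kato2004.rankZero_padicValNat_sha_le_sub_localTamagawa_of_additive_potGood_of_imageContainsSL2)
    (hDel : Delbourgo1998.prop4_rankZero_pow_dvd_constantCoeff)
    (hGZK : rank_eq_analyticRank_of_analyticRank_le_one) (hmod : hasEntireLFunction_rat)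
    (hmodD : nonempty_modularParametrizationData)
    (hKatoχ : Wuthrich2014.kato_halfEigenCharIdeal_dvd_cyclotomicPrime_of_surjective)
    (hCT : exists_casselsTate_pairing (K := ℚ))
    (hU : Silverman1994_thmV53_tateUniformisation.{0})
    (hU2 : Silverman1994_thmV53_corV54_tateUniformisation.{0})
    (W : WeierstrassCurve ℚ) [W.IsElliptic] [W.IsGloballyMinimal]
    (hI : integralModelInt W = ⟨1, -1, 0, -12348, -539312⟩)
    (hr : W.analyticRank = 0)
    {q : ℚ} (hq : shaAn W = (q : ℂ)) (hv : padicValRat 3 q ≤ 2)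
    (W' : WeierstrassCurve ℚ) (hW' : W' = ⟨0, 0, 1, -354, 2560⟩) [W'.IsElliptic]
    (θ : geomTorsion W' ((3 : ℕ) : ℤ) ≃+ geomTorsion W ((3 : ℕ) : ℤ))
    (hθ : ∀ (σ : Field.absoluteGaloisGroup ℚ) (P : geomTorsion W' ((3 : ℕ) : ℤ)),
      θ (σ • P) = σ • θ P)
    (hrank : 2 ≤ W'.mordellWeilRank) :
    haveI : Fact (Nat.Prime 3) := ⟨Nat.prime_three⟩
    BSDp W 3 := by
  haveI : Fact (Nat.Prime 3) := ⟨Nat.prime_three⟩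
  -- the row `61326h1`
  have hsurj : W.HasSurjectiveModNGaloisRep 3 := GaloisImage.surj3_frob_v61326h1 hI
  have hX : ClassX4 W 3 :=
    ⟨by norm_num, addv_of_intModel hI 3 (by decide) (by decide),
      hasIrreducibleModPGaloisRep_of_hasSurjectiveModNGaloisRep W 3 hsurj⟩
  have hj : padicValRat 3 W.j < 0 :=
    padicValRat_j_neg_of_intModel hI (p := 3) 2 (by decide) (by decide)
  have hE : (⟨1, -1, 0, -12348, -539312⟩ : WeierstrassCurve ℤ).map (Int.castRingHom ℚ) = W := by
    rw [IntModelTam.eq_baseChange_of_integralModelInt hI]; rfl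
  have hW : W = ⟨1, -1, 0, -12348, -539312⟩ := by
    rw [← hE]; exact map_mk_int 1 (-1) 0 (-12348) (-539312)
  -- the partner `30663a1`: globally minimal, integral model
  haveI hM' : W'.IsGloballyMinimal := by
    rw [hW']
    exact isGloballyMinimal_of_krausCriterion_bounded 0 0 1 (-354) 2560
      (by decide +kernel) (by decide +kernel) (by decide +kernel)
  have hI' : integralModelInt W' = ⟨0, 0, 1, -354, 2560⟩ := by
    subst hW'; exact integralModelInt_eq_of_map_eq _ (map_mk_int 0 0 1 (-354) 2560)
  have hF : (⟨0, 0, 1, -354, 2560⟩ : WeierstrassCurve ℤ).map (Int.castRingHom ℚ) = W' := by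
    rw [hW']; exact map_mk_int 0 0 1 (-354) 2560
  refine X4RankZero.bsdp_three_potMult_of_congr_of_places₇_of_primeList_paidThree hKatoS hDel hGZK
    hmod hmodD hKatoχ hCT hU hU2 W hr hX hsurj hj hq hv W' θ hθ (t := 1) (k := 2)
    (fun w hw ↦ (LocalTorsion3.natCard_ker_nsmul_three_adicCompletion_eq_one_of_check 0 0 1 (-354) 2560
      (by decide +kernel) (k := 2) (cert := [((24 : ℤ), 1, 3, 0)]) (by decide +kernel) W' hW' hw).le)
    (by norm_num) hrank hE hF [2, 3, 3407] (by decide)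
    (X11b.forall_mem_of_natAbs_eq_prod_pow [2, 3, 3407] [15, 10, 1] (by intro q hq; simp only [List.mem_cons, List.mem_nil_iff, or_false] at hq; rcases hq with rfl | rfl | rfl <;> norm_num) (by decide +kernel))
    (X11b.forall_mem_of_natAbs_eq_prod_pow [2, 3, 3407] [0, 7, 1] (by intro q hq; simp only [List.mem_cons, List.mem_nil_iff, or_false] at hq; rcases hq with rfl | rfl | rfl <;> norm_num) (by decide +kernel))
    (fun v hvL hv3 ↦ ?_)
  simp only [List.mem_cons, List.mem_nil_iff, or_false] at hvL
  rcases hvL with h2 | h3 | hℓ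
  · -- `v = 2`: kind (iv′) — `E` non-split multiplicative, `E′` good, `2 ≠ 3`
    have h2z : ((primesEquiv v : ℕ) : ℤ) = ((2 : ℕ) : ℤ) := by rw [h2]
    refine Or.inr <| Or.inr <| Or.inr <| Or.inl ⟨?_, nonsplit_numeral_61326h1_at2 W hW h2, ?_, ?_⟩
    · exact W.hasMultiplicativeReductionAt_of_dvd_of_not_dvd v
        (by rw [minimalDiscriminantInt, hI, h2z]; decide +kernel) (by rw [hI, h2z]; decide +kernel)
    · rw [← hF]
      exact hasGoodReductionAt_map_of_not_dvd _ v (by rw [h2z]; decide +kernel)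
    · intro hmem
      have h3' := Rat.HeightOneSpectrum.primesEquiv_eq_of_natCast_mem v Nat.prime_three hmem
      omega
  · -- `v = 3`: the PAID place, excluded here
    exact absurd h3 hv3
  · -- `v = 3407`: kind (iii) — both multiplicative, same twist class, `μ₃ = 1`
    have hℓz : ((primesEquiv v : ℕ) : ℤ) = ((3407 : ℕ) : ℤ) := by rw [hℓ]
    refine Or.inr <| Or.inr <| Or.inl ⟨?_, ?_, kind_iii_numerals_61326h1_30663a1_at3407 W W' hW hW' hℓ⟩
    · exact W.hasMultiplicativeReductionAt_of_dvd_of_not_dvd v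
        (by rw [minimalDiscriminantInt, hI, hℓz]; decide +kernel) (by rw [hI, hℓz]; decide +kernel)
    · exact W'.hasMultiplicativeReductionAt_of_dvd_of_not_dvd v
        (by rw [minimalDiscriminantInt, hI', hℓz]; decide +kernel) (by rw [hI', hℓz]; decide +kernel)

end Summit.BirchSwinnertonDyer.Rank1Residual.Additive

end
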